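import Literature.NumberTheory.GelbartRogawski1991.FiniteAdelicSplittingAssembly
import Literature.NumberTheory.GelbartRogawski1991.RationalSymplecticUnramifiedVector
import Literature.NumberTheory.Weil1964.AdelicMetaplecticGenerators
import Literature.NumberTheory.Automorphic.FiniteAdeleSchwartzBruhatTensor
import Literature.NumberTheory.Automorphic.RestrictedTensorProductLift
import Literature.NumberTheory.Automorphic.UnitaryGroupPlaceTruncation
import HarnessLib

-- buildfix G11b-3 recipe (LEDGER B13-1/B13-3): elaborate sequentially so the trailing `attribute [implicit_reducible]`
-- block (reducibilityCoreExt is keyed to the async environment branch) is in force at `.olean` export.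
set_option Elab.async false

/-!
# Finite implementers of RATIONAL symplectic elements, assembled place by place

[Weil1964, Chap. III n° 37–38 pp. 188–190, n° 40 p. 190]: for `γ ∈ Sp(X)_k` rational the metaplectic operator
`𝐫_k(γ)` is the restricted tensor product `⊗_v 𝐫_v(γ)` of local operators, almost all of which fix the standard
function `1_{𝒪_v}`. This file proves the OPERATOR form of that statement which the compatible-splitting construction
[GelbartRogawski1991, §3.1 Prop. 3.1.1] consumes, over the tree's adelic Schrödinger model:

* §1 a rational symplectic matrix `γ ∈ Sp_{2N}(F)` read in `Sp(𝕎_𝔸)` (`ratSp`, Gram matrix `𝕋 = T ⊗ 1`) LOCALISES at a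
  finite place `v` to `ratSpLoc v γ = transportSp T_v (γ ⊗ 1) ∈ Sp(𝕎_v)` of `RationalSymplecticUnramifiedVector` (`placeVec_ratSp`), and so does Weil's
  second-degree character `f_γ` (`adeleEval_ofSymplectic_f_ratSp`);
* §2 from a family of local implementers `M_v` of `ratSpLoc v γ` on `𝒮(F_vᴺ)` fixing `1_{𝒪_vᴺ}` for almost all `v`
  the restricted-tensor operator `⊗'_v M_v` on `𝒮_f = 𝒮((𝔸_F^∞)ᴺ)` (`piOp`, `piEquiv`; tree `IsRestrictedTensorProduct.map`
  on `piProdSB`), with `(⊗' M_v)(⊗_v Φ_v) = ⊗_v M_v Φ_v`;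
* §3 **`⊗'_v M_v` implements `ratSp γ` on the finite Heisenberg elements** (`piOp_comp_finSchrodinger`, `implements_fin`)
  — the factorwise action `finOp_piProdSB` + the local implementer property + §1;
* §4 hence EVERY `p ∈ Mp_ψ(𝕎_𝔸)ᶜᵒⁿᵗ` over `ratSp γ` (e.g. Weil's `r_F(γ)`) has `ω(p) = A ⊗ ⊗'_v M_v` with `A` a topological
  automorphism of `𝓢` (`exists_arch_tmul`, by the tree's tensor stripping `exists_continuousLinearEquiv_map_tmul_of_mem_adelicMpCont`);
* §5 conjugating a FINITE operator `1 ⊗ B` by such a `p`: `ω(p X p⁻¹)(Φ_∞ ⊗ f) = Φ_∞ ⊗ (⊗'M_v) B (⊗'M_v)⁻¹ f`, and for the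
  finite splitting `s_f` of `FiniteAdelicSplittingAssembly`: `ω(p · s_f(g) · p⁻¹)(Φ_∞ ⊗ ⊗_v Φ_v) = Φ_∞ ⊗ ⊗_v M_v ω_v(g_v) M_v⁻¹ Φ_v`,
  whose value at the origin is the FINITE PRODUCT `Φ_∞(0) ∏_{v ∈ S} (M_v ω_v(g_v) M_v⁻¹ Φ_v)(0)`;
* §6 **`conjOp_apply_zero`** — the local-to-global transfer of an ORIGIN-VALUE PRESCRIPTION [GelbartRogawski1991, Prop. 3.1.1;
  Kudla1994, Thm. 3.1]: if at each place `(M_v ω_v(u) M_v⁻¹ φ)(0) = λ(inclPlace v u) φ(0)` for `u` satisfying a placewise condition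
  `P_v` (`P_v 1`), with `λ` multiplicative and continuous on `P = {g | ∀ v, P_v g_v}`, then `(M_p ω(s_f g) M_p⁻¹ Φ)(0) = λ(g) Φ(0)` for
  all `g ∈ P`: pure tensors (§5), finitely supported `g` (`truncPlaces_insert`), density of `P ∩ finSupp` in `P`
  (`UnitaryGroupPlaceTruncation.subset_closure_inter_finSupp`) and continuity (the orbit maps of `s_f` are locally constant).

Kernel mathematics only: definitions with bodies and theorems; no Prop record, no named fact, no `sorry`.
-/

set_option autoImplicit false

noncomputable section

open scoped Matrix TensorProduct Classical RestrictedProduct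
open NumberField NumberField.mixedEmbedding IsDedekindDomain Filter
open Literature.RepresentationTheory.HeisenbergGroup
open Literature.NumberTheory.Automorphic
open Literature.NumberTheory.Weil1964

namespace Literature.NumberTheory.GelbartRogawski1991.UnitaryDualPair.LocalSplitting

variable (F : Type) [Field F] [NumberField F] (N : ℕ) (T : Matrix (Fin N) (Fin N) F) (hTd : IsUnit T.det)

set_option quotPrecheck false in
/-- the adelic Gram matrix `𝕋 = T ⊗ 1`. -/
local notation "𝕋" => Matrix.map T (algebraMap F (AdeleRing (𝓞 F) F))

/-! ## §1 Rational symplectic elements localise -/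

section Localise

/-- components of principal adeles: `(q ⊗ 1)_v = q`. [folklore] -/
private theorem adeleEval_algebraMap' (v : HeightOneSpectrum (𝓞 F)) (q : F) :
    AdelicGroupData.adeleEval F v (algebraMap F (AdeleRing (𝓞 F) F) q) = algebraMap F (v.adicCompletion F) q := by
  rw [AdelicGroupData.adeleEval_apply]
  exact FiniteAdeleRing.algebraMap_apply (𝓞 F) F q v

/-- `𝕋` read at `v` is `T ⊗ F_v`. [folklore] -/
private theorem map_adeleEval_gram' (v : HeightOneSpectrum (𝓞 F)) :
    (𝕋).map (AdelicGroupData.adeleEval F v) = localGram F N T v :=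
  Matrix.ext fun i j => by simp only [Matrix.map_apply]; exact adeleEval_algebraMap' F v (T i j)

/-- `γ ⊗ 1 ∈ Sp_{2N}(𝔸_F)` read at `v` is `γ ⊗ 1 ∈ Sp_{2N}(F_v)`. [folklore] -/
private theorem map_adeleEval_mapHom (v : HeightOneSpectrum (𝓞 F)) (γ : Matrix.symplecticGroup (Fin N) F) :
    ((SymplecticMatrix.mapHom (algebraMap F (AdeleRing (𝓞 F) F)) γ : Matrix.symplecticGroup (Fin N) (AdeleRing (𝓞 F) F)) :
        Matrix (Fin N ⊕ Fin N) (Fin N ⊕ Fin N) (AdeleRing (𝓞 F) F)).map (AdelicGroupData.adeleEval F v) =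
      ((SymplecticMatrix.mapHom (algebraMap F (v.adicCompletion F)) γ : Matrix.symplecticGroup (Fin N) (v.adicCompletion F)) :
        Matrix (Fin N ⊕ Fin N) (Fin N ⊕ Fin N) (v.adicCompletion F)) := by
  rw [SymplecticMatrix.coe_mapHom, SymplecticMatrix.coe_mapHom, Matrix.map_map]
  exact Matrix.ext fun i j => by simp only [Matrix.map_apply, Function.comp_apply]; exact adeleEval_algebraMap' F v _

/-- the Darboux coordinates localise: `(P_𝕋 w)_v = P_{T_v} (w_v)`. [folklore] -/
private theorem adeleEval_darboux (v : HeightOneSpectrum (𝓞 F)) (w : (Fin N → AdeleRing (𝓞 F) F) × (Fin N → AdeleRing (𝓞 F) F)) :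
    (AdelicGroupData.adeleEval F v) ∘ (SymplecticMatrix.darboux 𝕋 (isUnit_det_gramAdele F N T hTd) w) =
      SymplecticMatrix.darboux (localGram F N T v) (isUnit_det_localGram F N T hTd v) (UnitaryGroup.placeVec F N v w) := by
  funext k
  rw [SymplecticMatrix.darboux_apply, SymplecticMatrix.darboux_apply, Function.comp_apply]
  rcases k with i | i
  · rfl
  · rw [Sum.elim_inr, Sum.elim_inr, RingHom.map_mulVec, map_adeleEval_gram']
    rfl

/-- **`(ratSp γ w)_v = ratSpLoc v γ (w_v)`**: a rational symplectic matrix acts componentwise.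
[cite: Weil1964, Chap. III n° 37 p. 188] -/
theorem placeVec_ratSp (v : HeightOneSpectrum (𝓞 F)) (γ : Matrix.symplecticGroup (Fin N) F)
    (w : (Fin N → AdeleRing (𝓞 F) F) × (Fin N → AdeleRing (𝓞 F) F)) :
    UnitaryGroup.placeVec F N v ((ratSp F 𝕋 (isUnit_det_gramAdele F N T hTd) γ).1 w) =
      (ratSpLoc F N T hTd v γ).1 (UnitaryGroup.placeVec F N v w) := by
  apply (SymplecticMatrix.darboux (localGram F N T v) (isUnit_det_localGram F N T hTd v)).injective
  have hA : SymplecticMatrix.darboux 𝕋 (isUnit_det_gramAdele F N T hTd) ((ratSp F 𝕋 (isUnit_det_gramAdele F N T hTd) γ).1 w) =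
      ((SymplecticMatrix.mapHom (algebraMap F (AdeleRing (𝓞 F) F)) γ : Matrix.symplecticGroup (Fin N) (AdeleRing (𝓞 F) F)) :
        Matrix (Fin N ⊕ Fin N) (Fin N ⊕ Fin N) (AdeleRing (𝓞 F) F)) *ᵥ
          SymplecticMatrix.darboux 𝕋 (isUnit_det_gramAdele F N T hTd) w := by
    change SymplecticMatrix.darboux 𝕋 _ ((SymplecticMatrix.transportSp 𝕋 (isUnit_det_gramAdele F N T hTd)
      (SymplecticMatrix.mapHom (algebraMap F (AdeleRing (𝓞 F) F)) γ)).1 w) = _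
    rw [SymplecticMatrix.coe_transportSp_apply, LinearEquiv.apply_symm_apply]
  have hB : SymplecticMatrix.darboux (localGram F N T v) (isUnit_det_localGram F N T hTd v)
      ((ratSpLoc F N T hTd v γ).1 (UnitaryGroup.placeVec F N v w)) =
      ((SymplecticMatrix.mapHom (algebraMap F (v.adicCompletion F)) γ : Matrix.symplecticGroup (Fin N) (v.adicCompletion F)) :
        Matrix (Fin N ⊕ Fin N) (Fin N ⊕ Fin N) (v.adicCompletion F)) *ᵥ
          SymplecticMatrix.darboux (localGram F N T v) (isUnit_det_localGram F N T hTd v) (UnitaryGroup.placeVec F N v w) := by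
    change SymplecticMatrix.darboux _ _ ((SymplecticMatrix.transportSp (localGram F N T v) (isUnit_det_localGram F N T hTd v)
      (SymplecticMatrix.mapHom (algebraMap F (v.adicCompletion F)) γ)).1 _) = _
    rw [SymplecticMatrix.coe_transportSp_apply, LinearEquiv.apply_symm_apply]
  rw [hB, ← adeleEval_darboux F N T hTd v, ← adeleEval_darboux F N T hTd v, hA, ← map_adeleEval_mapHom F N v γ]
  funext k
  rw [Function.comp_apply, RingHom.map_mulVec]

/-- **Weil's second-degree character of a rational element localises**: `f_{ratSp γ}(w)_v = f_{ratSpLoc v γ}(w_v)`.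
[cite: Weil1964, Chap. I n° 5 pp. 150–151] -/
theorem adeleEval_ofSymplectic_f_ratSp (v : HeightOneSpectrum (𝓞 F)) (γ : Matrix.symplecticGroup (Fin N) F)
    (w : (Fin N → AdeleRing (𝓞 F) F) × (Fin N → AdeleRing (𝓞 F) F)) :
    AdelicGroupData.adeleEval F v ((ofSymplectic _ (ratSp F 𝕋 (isUnit_det_gramAdele F N T hTd) γ)).f w) =
      (ofSymplectic (polar (localPairing F N T v)) (ratSpLoc F N T hTd v γ)).f (UnitaryGroup.placeVec F N v w) := by
  have h2 : AdelicGroupData.adeleEval F v (⅟(2 : AdeleRing (𝓞 F) F)) = ⅟(2 : v.adicCompletion F) := by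
    have h : AdelicGroupData.adeleEval F v (⅟(2 : AdeleRing (𝓞 F) F)) * 2 = 1 := by
      rw [← map_ofNat (AdelicGroupData.adeleEval F v) 2, ← map_mul, invOf_mul_self, map_one]
    exact (invOf_eq_left_inv h).symm
  rw [ofSymplectic_f, ofSymplectic_f, map_mul, map_sub, h2, polar_apply, polar_apply, polar_apply, polar_apply,
    adeleEval_adelicForm, adeleEval_adelicForm, ← placeVec_ratSp]
  rfl

end Localise

/-! ## §2 The restricted-tensor operator `⊗'_v M_v` of a family of local operators -/

section PiOp

variable {F N}
variable (M : ∀ v : HeightOneSpectrum (𝓞 F),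
    SchwartzBruhat (Fin N → v.adicCompletion F) ≃ₗ[ℂ] SchwartzBruhat (Fin N → v.adicCompletion F))
  (hM1 : ∀ᶠ v in cofinite, M v (unitVec F (Fin N) v) = unitVec F (Fin N) v)

include hM1 in
/-- the inverses also fix the unit vectors almost everywhere. [cite: Weil1964, Chap. III n° 38 p. 190] -/
theorem eventually_symm_unitVec : ∀ᶠ v in cofinite, (M v).symm (unitVec F (Fin N) v) = unitVec F (Fin N) v :=
  hM1.mono fun v hv => (M v).symm_apply_eq.2 hv.symm

/-- **`⊗'_v M_v`** on `𝒮((𝔸_F^∞)ᴺ)` (restricted tensor product of linear maps fixing the base vectors a.e., on the model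
`piProdSB`). [cite: Weil1964, Chap. III n° 38 p. 190] -/
def piOp : FinSB F (Fin N) →ₗ[ℂ] FinSB F (Fin N) :=
  (isRestrictedTensorProduct_piProdSB F (Fin N)).map (isRestrictedMultilinear_piProdSB F (Fin N))
    (fun v => (M v : SchwartzBruhat (Fin N → v.adicCompletion F) →ₗ[ℂ] SchwartzBruhat (Fin N → v.adicCompletion F))) hM1

/-- `⊗'_v M_v⁻¹`. [cite: Weil1964, Chap. III n° 38 p. 190] -/
def piOpInv : FinSB F (Fin N) →ₗ[ℂ] FinSB F (Fin N) :=
  (isRestrictedTensorProduct_piProdSB F (Fin N)).map (isRestrictedMultilinear_piProdSB F (Fin N))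
    (fun v => ((M v).symm : SchwartzBruhat (Fin N → v.adicCompletion F) →ₗ[ℂ] SchwartzBruhat (Fin N → v.adicCompletion F)))
    (eventually_symm_unitVec M hM1)

/-- **`(⊗' M_v)(⊗_v Φ_v) = ⊗_v M_v Φ_v`**. [cite: Weil1964, Chap. III n° 38 p. 190] -/
theorem piOp_piProdSB (Φ : LocalSBFamily F (Fin N)) :
    piOp M hM1 (piProdSB F (Fin N) Φ) = piProdSB F (Fin N) (RestrictedFamily.piMap
      (fun v => (M v : SchwartzBruhat (Fin N → v.adicCompletion F) →ₗ[ℂ] SchwartzBruhat (Fin N → v.adicCompletion F)))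
      hM1 Φ) :=
  IsRestrictedTensorProduct.map_apply _ _ _ _ Φ

/-- `(⊗' M_v⁻¹)(⊗_v Φ_v) = ⊗_v M_v⁻¹ Φ_v`. [cite: Weil1964, Chap. III n° 38 p. 190] -/
theorem piOpInv_piProdSB (Φ : LocalSBFamily F (Fin N)) :
    piOpInv M hM1 (piProdSB F (Fin N) Φ) = piProdSB F (Fin N) (RestrictedFamily.piMap
      (fun v => ((M v).symm : SchwartzBruhat (Fin N → v.adicCompletion F) →ₗ[ℂ] SchwartzBruhat (Fin N → v.adicCompletion F)))
      (eventually_symm_unitVec M hM1) Φ) :=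
  IsRestrictedTensorProduct.map_apply _ _ _ _ Φ

/-- `(⊗' M_v) ∘ (⊗' M_v⁻¹) = 1`. [folklore] -/
private theorem piOp_comp_piOpInv : piOp M hM1 ∘ₗ piOpInv M hM1 = LinearMap.id := by
  refine LinearMap.ext_on_range (span_range_piProdSB (K := F) (ι := Fin N)) fun Φ => ?_
  rw [LinearMap.comp_apply, LinearMap.id_apply, piOpInv_piProdSB, piOp_piProdSB]
  congr 1
  exact RestrictedProduct.ext _ _ fun v => (M v).apply_symm_apply (Φ v)

/-- `(⊗' M_v⁻¹) ∘ (⊗' M_v) = 1`. [folklore] -/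
private theorem piOpInv_comp_piOp : piOpInv M hM1 ∘ₗ piOp M hM1 = LinearMap.id := by
  refine LinearMap.ext_on_range (span_range_piProdSB (K := F) (ι := Fin N)) fun Φ => ?_
  rw [LinearMap.comp_apply, LinearMap.id_apply, piOp_piProdSB, piOpInv_piProdSB]
  congr 1
  exact RestrictedProduct.ext _ _ fun v => (M v).symm_apply_apply (Φ v)

/-- **`⊗'_v M_v` as a linear automorphism of `𝒮_f`**, inverse `⊗'_v M_v⁻¹`. [cite: Weil1964, Chap. III n° 38 p. 190] -/
def piEquiv : FinSB F (Fin N) ≃ₗ[ℂ] FinSB F (Fin N) :=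
  LinearEquiv.ofLinear (piOp M hM1) (piOpInv M hM1) (piOp_comp_piOpInv M hM1) (piOpInv_comp_piOp M hM1)

/-- `piEquiv = ⊗' M_v` as a linear map. [cite: Weil1964, Chap. III n° 38 p. 190] -/
@[simp] theorem coe_piEquiv : (piEquiv M hM1 : FinSB F (Fin N) →ₗ[ℂ] FinSB F (Fin N)) = piOp M hM1 := rfl

/-- `piEquiv⁻¹ = ⊗' M_v⁻¹` as a linear map. [cite: Weil1964, Chap. III n° 38 p. 190] -/
@[simp] theorem coe_piEquiv_symm : ((piEquiv M hM1).symm : FinSB F (Fin N) →ₗ[ℂ] FinSB F (Fin N)) = piOpInv M hM1 := rfl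

/-- `piEquiv (⊗Φ_v) = ⊗ M_v Φ_v`. [cite: Weil1964, Chap. III n° 38 p. 190] -/
theorem piEquiv_piProdSB (Φ : LocalSBFamily F (Fin N)) :
    piEquiv M hM1 (piProdSB F (Fin N) Φ) = piProdSB F (Fin N) (RestrictedFamily.piMap
      (fun v => (M v : SchwartzBruhat (Fin N → v.adicCompletion F) →ₗ[ℂ] SchwartzBruhat (Fin N → v.adicCompletion F)))
      hM1 Φ) :=
  piOp_piProdSB M hM1 Φ

/-- `piEquiv⁻¹ (⊗Φ_v) = ⊗ M_v⁻¹ Φ_v`. [cite: Weil1964, Chap. III n° 38 p. 190] -/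
theorem piEquiv_symm_piProdSB (Φ : LocalSBFamily F (Fin N)) :
    (piEquiv M hM1).symm (piProdSB F (Fin N) Φ) = piProdSB F (Fin N) (RestrictedFamily.piMap
      (fun v => ((M v).symm : SchwartzBruhat (Fin N → v.adicCompletion F) →ₗ[ℂ] SchwartzBruhat (Fin N → v.adicCompletion F)))
      (eventually_symm_unitVec M hM1) Φ) :=
  piOpInv_piProdSB M hM1 Φ

end PiOp

/-! ## §3 `⊗'_v M_v` implements `ratSp γ` on the finite Heisenberg elements -/

section ImplementsFin

variable {F N}
variable (γ : Matrix.symplecticGroup (Fin N) F)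
  (M : ∀ v : HeightOneSpectrum (𝓞 F),
    SchwartzBruhat (Fin N → v.adicCompletion F) ≃ₗ[ℂ] SchwartzBruhat (Fin N → v.adicCompletion F))
  (hM : ∀ v, Implements (localSchrodinger F N T v) (ofSymplectic _ (ratSpLoc F N T hTd v γ)) (M v))
  (hM1 : ∀ᶠ v in cofinite, M v (unitVec F (Fin N) v) = unitVec F (Fin N) v)

include hM in
/-- **place components**: `M_v ρ_v(h_v) Φ_v = ψ_v(f_γ(w)_v) · ρ_v((γh)_v) M_v Φ_v`. [cite: Weil1964, Chap. III n° 37–38 pp. 188–190] -/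
theorem piMap_heisFamily_apply (h : AdelicHeisenberg F (Fin N) 𝕋) (Φ : LocalSBFamily F (Fin N)) (v : HeightOneSpectrum (𝓞 F)) :
    (RestrictedFamily.piMap
        (fun v => (M v : SchwartzBruhat (Fin N → v.adicCompletion F) →ₗ[ℂ] SchwartzBruhat (Fin N → v.adicCompletion F)))
        hM1 (heisFamily T h Φ) v : SchwartzBruhat (Fin N → v.adicCompletion F)) =
      ((adeleAddCharAt F v (((ofSymplectic _ (ratSp F 𝕋 (isUnit_det_gramAdele F N T hTd) γ)).f h.v).2 v) : Circle) : ℂ) •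
        (heisFamily T ((ofSymplectic (polar (Weil1964.adelicForm F (Fin N) 𝕋))
            (ratSp F 𝕋 (isUnit_det_gramAdele F N T hTd) γ)).act h)
          (RestrictedFamily.piMap
            (fun v => (M v : SchwartzBruhat (Fin N → v.adicCompletion F) →ₗ[ℂ] SchwartzBruhat (Fin N → v.adicCompletion F)))
            hM1 Φ) v : SchwartzBruhat (Fin N → v.adicCompletion F)) := by
  rw [RestrictedFamily.piMap_apply, heisFamily_apply, heisFamily_apply, RestrictedFamily.piMap_apply]
  have hact : (ofSymplectic (polar (localPairing F N T v)) (ratSpLoc F N T hTd v γ)).act (heisLoc T h v) =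
      ⟨(heisLoc T ((ofSymplectic (polar (Weil1964.adelicForm F (Fin N) 𝕋))
          (ratSp F 𝕋 (isUnit_det_gramAdele F N T hTd) γ)).act h) v).v,
        ((ofSymplectic _ (ratSp F 𝕋 (isUnit_det_gramAdele F N T hTd) γ)).f h.v).2 v⟩ := by
    refine Heisenberg.ext ?_ ?_
    · rw [Heisenberg.PseudoSymplectic.act_v, ofSymplectic_σ]
      change (ratSpLoc F N T hTd v γ).1 (UnitaryGroup.placeVec F N v h.v) =
        UnitaryGroup.placeVec F N v ((ratSp F 𝕋 (isUnit_det_gramAdele F N T hTd) γ).1 h.v)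
      rw [placeVec_ratSp]
    · rw [Heisenberg.PseudoSymplectic.act_t]
      change (0 : v.adicCompletion F) + _ =
        AdelicGroupData.adeleEval F v ((ofSymplectic _ (ratSp F 𝕋 (isUnit_det_gramAdele F N T hTd) γ)).f h.v)
      rw [zero_add, adeleEval_ofSymplectic_f_ratSp]
      rfl
  have key := (hM v) (heisLoc T h v) (Φ v)
  rw [hact, localSchrodinger_mk_eq_smul F N T v
    (heisLoc T ((ofSymplectic (polar (Weil1964.adelicForm F (Fin N) 𝕋))
      (ratSp F 𝕋 (isUnit_det_gramAdele F N T hTd) γ)).act h) v).v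
    (((ofSymplectic _ (ratSp F 𝕋 (isUnit_det_gramAdele F N T hTd) γ)).f h.v).2 v)] at key
  exact key

include hM in
/-- **finite Heisenberg elements, finite factor**: `(⊗'M_v) ρ_f(h) = ρ_f(γh) (⊗'M_v)`. [cite: Weil1964, Chap. III n° 37–38 pp. 188–190] -/
theorem piOp_comp_finSchrodinger {h : AdelicHeisenberg F (Fin N) 𝕋} (hh : h ∈ finHeisenberg 𝕋) :
    piOp M hM1 ∘ₗ finSchrodinger 𝕋 h =
      finSchrodinger 𝕋 ((ofSymplectic (polar (Weil1964.adelicForm F (Fin N) 𝕋))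
        (ratSp F 𝕋 (isUnit_det_gramAdele F N T hTd) γ)).act h) ∘ₗ piOp M hM1 := by
  refine LinearMap.ext_on_range (span_range_piProdSB (K := F) (ι := Fin N)) fun Φ => ?_
  rw [LinearMap.comp_apply, LinearMap.comp_apply, finSchrodinger_def, finSchrodinger_def, LinearMap.smul_apply,
    LinearMap.smul_apply, map_smul, finOp_piProdSB, piOp_piProdSB, piOp_piProdSB, finOp_piProdSB,
    piProdSB_eq_smul_of_forall F N _ _ (((ofSymplectic _ (ratSp F 𝕋 (isUnit_det_gramAdele F N T hTd) γ)).f h.v).2)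
      (piMap_heisFamily_apply T hTd γ M hM hM1 h Φ),
    smul_smul, Heisenberg.PseudoSymplectic.act_t, AddChar.map_add_eq_mul, Circle.coe_mul,
    adeleAddChar_eq_finiteAdeleAddChar_of_fst_eq_zero F (fst_ofSymplectic_f_eq_zero F N T _ hh)]

include hM in
/-- **`1 ⊗ ⊗'_v M_v` implements `ratSp γ` on the finite Heisenberg elements of the global model.**
[cite: Weil1964, Chap. III n° 37–38 pp. 188–190] -/
theorem implements_fin {h : AdelicHeisenberg F (Fin N) 𝕋} (hh : h ∈ finHeisenberg 𝕋) (Φ : piSchwartzBruhat F (Fin N)) :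
    adelicTensorEnd LinearMap.id (piEquiv M hM1 : FinSB F (Fin N) →ₗ[ℂ] FinSB F (Fin N)) (adelicSchrodinger F (Fin N) 𝕋 h Φ) =
      adelicSchrodinger F (Fin N) 𝕋 ((ofSymplectic (polar (Weil1964.adelicForm F (Fin N) 𝕋))
        (ratSp F 𝕋 (isUnit_det_gramAdele F N T hTd) γ)).act h)
        (adelicTensorEnd LinearMap.id (piEquiv M hM1 : FinSB F (Fin N) →ₗ[ℂ] FinSB F (Fin N)) Φ) := by
  rw [coe_piEquiv, adelicSchrodinger_eq_adelicTensorEnd_finSchrodinger hh,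
    adelicSchrodinger_eq_adelicTensorEnd_finSchrodinger (act_mem_finHeisenberg _ hh), ← LinearMap.comp_apply,
    ← LinearMap.comp_apply (adelicTensorEnd _ _), ← adelicTensorEnd_comp, ← adelicTensorEnd_comp,
    piOp_comp_finSchrodinger T hTd γ M hM hM1 hh]

/-! ## §4 Every `p ∈ Mp_ψ(𝕎_𝔸)ᶜᵒⁿᵗ` over `ratSp γ` is `A ⊗ ⊗'_v M_v` -/

include hM in
/-- **tensor form of the implementers of a rational element**: for `p = (ratSp γ, M_p) ∈ Mp_ψ(𝕎_𝔸)ᶜᵒⁿᵗ` there is a topological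
automorphism `A` of `𝓢((F ⊗ ℝ)ᴺ)` with `M_p(Φ_∞ ⊗ f) = A Φ_∞ ⊗ (⊗'M_v) f` and `M_p⁻¹(Φ_∞ ⊗ f) = A⁻¹ Φ_∞ ⊗ (⊗'M_v)⁻¹ f`.
[cite: Weil1964, Chap. III n° 38–40 pp. 190–191] -/
theorem exists_arch_tmul (p : adelicMp F (Fin N) 𝕋) (hp : p ∈ adelicMpCont F (Fin N) 𝕋)
    (hproj : (p : symplecticGroup (polar (Weil1964.adelicForm F (Fin N) 𝕋)) ×
      (piSchwartzBruhat F (Fin N) ≃ₗ[ℂ] piSchwartzBruhat F (Fin N))).1 = ratSp F 𝕋 (isUnit_det_gramAdele F N T hTd) γ) :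
    ∃ A : SchwartzMap (Fin N → mixedSpace F) ℂ ≃L[ℂ] SchwartzMap (Fin N → mixedSpace F) ℂ,
      ∀ (Φinf : SchwartzMap (Fin N → mixedSpace F) ℂ) (f : FinSB F (Fin N)),
        (p : symplecticGroup (polar (Weil1964.adelicForm F (Fin N) 𝕋)) ×
            (piSchwartzBruhat F (Fin N) ≃ₗ[ℂ] piSchwartzBruhat F (Fin N))).2 (piSchwartzBruhatEquiv F (Fin N) (Φinf ⊗ₜ f)) =
          piSchwartzBruhatEquiv F (Fin N) (A Φinf ⊗ₜ piEquiv M hM1 f) ∧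
        (p : symplecticGroup (polar (Weil1964.adelicForm F (Fin N) 𝕋)) ×
            (piSchwartzBruhat F (Fin N) ≃ₗ[ℂ] piSchwartzBruhat F (Fin N))).2.symm (piSchwartzBruhatEquiv F (Fin N) (Φinf ⊗ₜ f)) =
          piSchwartzBruhatEquiv F (Fin N) (A.symm Φinf ⊗ₜ (piEquiv M hM1).symm f) :=
  exists_continuousLinearEquiv_map_tmul_of_mem_adelicMpCont
    (mulVec_surjective_of_isUnit_det F 𝕋 (isUnit_det_gramAdele F N T hTd)) p hp (piEquiv M hM1)
    fun h hh Φ => by rw [hproj]; exact implements_fin T hTd γ M hM hM1 hh Φ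

end ImplementsFin

/-! ## §5 Conjugating finite operators, and the finite splitting, by such a `p` -/

section Conjugate

variable {F N}

/-- **conjugating a finite operator by a tensor-form pair**: if `M_p(Φ_∞ ⊗ f) = AΦ_∞ ⊗ P f`, `M_p⁻¹(Φ_∞ ⊗ f) = A⁻¹Φ_∞ ⊗ P⁻¹f`
and `M_X(Φ_∞ ⊗ f) = Φ_∞ ⊗ B f`, then `M_p M_X M_p⁻¹ (Φ_∞ ⊗ f) = Φ_∞ ⊗ P B P⁻¹ f`. [cite: Weil1964, Chap. III n° 38 p. 190] -/
theorem conj_tmul_of_tensor_forms {Mp MX : piSchwartzBruhat F (Fin N) ≃ₗ[ℂ] piSchwartzBruhat F (Fin N)}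
    {A : SchwartzMap (Fin N → mixedSpace F) ℂ ≃L[ℂ] SchwartzMap (Fin N → mixedSpace F) ℂ}
    {P : FinSB F (Fin N) ≃ₗ[ℂ] FinSB F (Fin N)} {B : FinSB F (Fin N) →ₗ[ℂ] FinSB F (Fin N)}
    (hp : ∀ (Φinf : SchwartzMap (Fin N → mixedSpace F) ℂ) (f : FinSB F (Fin N)),
      Mp (piSchwartzBruhatEquiv F (Fin N) (Φinf ⊗ₜ f)) = piSchwartzBruhatEquiv F (Fin N) (A Φinf ⊗ₜ P f))
    (hp' : ∀ (Φinf : SchwartzMap (Fin N → mixedSpace F) ℂ) (f : FinSB F (Fin N)),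
      Mp.symm (piSchwartzBruhatEquiv F (Fin N) (Φinf ⊗ₜ f)) = piSchwartzBruhatEquiv F (Fin N) (A.symm Φinf ⊗ₜ P.symm f))
    (hX : ∀ (Φinf : SchwartzMap (Fin N → mixedSpace F) ℂ) (f : FinSB F (Fin N)),
      MX (piSchwartzBruhatEquiv F (Fin N) (Φinf ⊗ₜ f)) = piSchwartzBruhatEquiv F (Fin N) (Φinf ⊗ₜ B f))
    (Φinf : SchwartzMap (Fin N → mixedSpace F) ℂ) (f : FinSB F (Fin N)) :
    (Mp * MX * Mp⁻¹) (piSchwartzBruhatEquiv F (Fin N) (Φinf ⊗ₜ f)) =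
      piSchwartzBruhatEquiv F (Fin N) (Φinf ⊗ₜ P (B (P.symm f))) := by
  rw [LinearEquiv.mul_apply, LinearEquiv.mul_apply]
  change Mp (MX (Mp.symm _)) = _
  rw [hp', hX, hp, ContinuousLinearEquiv.apply_symm_apply]

/-- **conjugating an ARCHIMEDEAN operator by a tensor-form pair**: if `M_p(Φ_∞ ⊗ f) = AΦ_∞ ⊗ P f`,
`M_p⁻¹(Φ_∞ ⊗ f) = A⁻¹Φ_∞ ⊗ P⁻¹f` and `M_X(Φ_∞ ⊗ f) = B Φ_∞ ⊗ f`, then `M_p M_X M_p⁻¹ (Φ_∞ ⊗ f) = (A B A⁻¹ Φ_∞) ⊗ f` (the shape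
used by the archimedean half of the splitting). [cite: Weil1964, Chap. III n° 38 p. 190] -/
theorem conj_tmul_of_tensor_forms_arch {Mp MX : piSchwartzBruhat F (Fin N) ≃ₗ[ℂ] piSchwartzBruhat F (Fin N)}
    {A : SchwartzMap (Fin N → mixedSpace F) ℂ ≃L[ℂ] SchwartzMap (Fin N → mixedSpace F) ℂ}
    {P : FinSB F (Fin N) ≃ₗ[ℂ] FinSB F (Fin N)}
    {B : SchwartzMap (Fin N → mixedSpace F) ℂ →ₗ[ℂ] SchwartzMap (Fin N → mixedSpace F) ℂ}
    (hp : ∀ (Φinf : SchwartzMap (Fin N → mixedSpace F) ℂ) (f : FinSB F (Fin N)),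
      Mp (piSchwartzBruhatEquiv F (Fin N) (Φinf ⊗ₜ f)) = piSchwartzBruhatEquiv F (Fin N) (A Φinf ⊗ₜ P f))
    (hp' : ∀ (Φinf : SchwartzMap (Fin N → mixedSpace F) ℂ) (f : FinSB F (Fin N)),
      Mp.symm (piSchwartzBruhatEquiv F (Fin N) (Φinf ⊗ₜ f)) = piSchwartzBruhatEquiv F (Fin N) (A.symm Φinf ⊗ₜ P.symm f))
    (hX : ∀ (Φinf : SchwartzMap (Fin N → mixedSpace F) ℂ) (f : FinSB F (Fin N)),
      MX (piSchwartzBruhatEquiv F (Fin N) (Φinf ⊗ₜ f)) = piSchwartzBruhatEquiv F (Fin N) (B Φinf ⊗ₜ f))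
    (Φinf : SchwartzMap (Fin N → mixedSpace F) ℂ) (f : FinSB F (Fin N)) :
    (Mp * MX * Mp⁻¹) (piSchwartzBruhatEquiv F (Fin N) (Φinf ⊗ₜ f)) =
      piSchwartzBruhatEquiv F (Fin N) (A (B (A.symm Φinf)) ⊗ₜ f) := by
  rw [LinearEquiv.mul_apply, LinearEquiv.mul_apply]
  change Mp (MX (Mp.symm _)) = _
  rw [hp', hX, hp, LinearEquiv.apply_symm_apply]

/-- the value of a pure tensor at the origin: `(Φ_∞ ⊗ f)(0) = Φ_∞(0) f(0)`. [cite: Weil1964, Chap. III n° 37 p. 188] -/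
theorem coe_piSchwartzBruhatEquiv_tmul_zero (Φinf : SchwartzMap (Fin N → mixedSpace F) ℂ) (f : FinSB F (Fin N)) :
    ((piSchwartzBruhatEquiv F (Fin N) (Φinf ⊗ₜ f) : piSchwartzBruhat F (Fin N)) : (Fin N → AdeleRing (𝓞 F) F) → ℂ) 0 =
      Φinf 0 * (f : (Fin N → FiniteAdeleRing (𝓞 F) F) → ℂ) 0 := by
  rw [coe_piSchwartzBruhatEquiv_tmul]
  have h1 : piArch F (Fin N) (0 : Fin N → AdeleRing (𝓞 F) F) = 0 := funext fun i => by rw [piArch_apply]; exact map_zero _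
  have h2 : piFinite F (Fin N) (0 : Fin N → AdeleRing (𝓞 F) F) = 0 := rfl
  simp only [h1, h2]

/-- the value of a pure tensor `⊗_v Y_v` at the origin: `∏_{v ∈ S} Y_v(0)` for any finite `S` off which `Y_v = 1_{𝒪_vᴺ}`.
[cite: Weil1964, Chap. III n° 37 p. 188] -/
theorem coe_piProdSB_zero (Y : LocalSBFamily F (Fin N)) (S : Finset (HeightOneSpectrum (𝓞 F)))
    (hY : ∀ v ∉ S, Y v = unitVec F (Fin N) v) :
    ((piProdSB F (Fin N) Y : FinSB F (Fin N)) : (Fin N → FiniteAdeleRing (𝓞 F) F) → ℂ) 0 =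
      ∏ v ∈ S, ((Y v : SchwartzBruhat (Fin N → v.adicCompletion F)) : (Fin N → v.adicCompletion F) → ℂ) 0 := by
  rw [coe_piProdSB, piProd_eq_prod Y 0 S hY (fun v _ i => zero_mem _)]
  exact Finset.prod_congr rfl fun v _ => by rw [localFactor_apply]; rfl

variable (E : Type) [Field E] [NumberField E] [Algebra F E] [Algebra.IsQuadraticExtension F E] (c : E ≃ₐ[F] E)
  {δ : E} (hcδ : c δ = -δ) (hδ : δ ≠ 0) {d : F} (hd : δ * δ = algebraMap F E d) (hT : T.IsSymm)
  {J : Matrix (Fin N) (Fin N) E} (hJ : J = T.map (algebraMap F E))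
  (𝓢 : FinLocalSplittings F E c N hcδ hδ hd T hT hJ)
  (M : ∀ v : HeightOneSpectrum (𝓞 F),
    SchwartzBruhat (Fin N → v.adicCompletion F) ≃ₗ[ℂ] SchwartzBruhat (Fin N → v.adicCompletion F))
  (hM1 : ∀ᶠ v in cofinite, M v (unitVec F (Fin N) v) = unitVec F (Fin N) v)

/-- the conjugated local family `v ↦ M_v ω_v(g_v) M_v⁻¹ Φ_v`. [cite: GelbartRogawski1991, §3.1 Prop. 3.1.1 p. 455 L1–3] -/
def conjFamily (g : UnitaryGroup.finAdelic F E c N J) (Φ : LocalSBFamily F (Fin N)) : LocalSBFamily F (Fin N) :=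
  RestrictedFamily.piMap
    (fun v => (M v : SchwartzBruhat (Fin N → v.adicCompletion F) →ₗ[ℂ] SchwartzBruhat (Fin N → v.adicCompletion F))) hM1
    (RestrictedFamily.smul 𝓢.omegaLoc 𝓢.unitVec_mem_fixedPoints (UnitaryGroup.finAdelicEquiv F E c N J g)
      (RestrictedFamily.piMap
        (fun v => ((M v).symm : SchwartzBruhat (Fin N → v.adicCompletion F) →ₗ[ℂ] SchwartzBruhat (Fin N → v.adicCompletion F)))
        (eventually_symm_unitVec M hM1) Φ))

/-- components of `conjFamily`. [cite: GelbartRogawski1991, §3.1 Prop. 3.1.1 p. 455 L1–3] -/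
@[simp] theorem conjFamily_apply (g : UnitaryGroup.finAdelic F E c N J) (Φ : LocalSBFamily F (Fin N)) (v : HeightOneSpectrum (𝓞 F)) :
    conjFamily T E c hcδ hδ hd hT hJ 𝓢 M hM1 g Φ v = M v (𝓢.omegaLoc v (UnitaryGroup.evalPlace F E c N J v g) ((M v).symm (Φ v))) := rfl

/-- **conjugating the finite splitting by a tensor-form pair**: `(M_p (1 ⊗ Ω(g)) M_p⁻¹)(Φ_∞ ⊗ ⊗_v Φ_v) =
Φ_∞ ⊗ ⊗_v M_v ω_v(g_v) M_v⁻¹ Φ_v`. [cite: GelbartRogawski1991, §3.1 Prop. 3.1.1 p. 455] -/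
theorem conj_finSplitting_tmul_piProdSB {Mp : piSchwartzBruhat F (Fin N) ≃ₗ[ℂ] piSchwartzBruhat F (Fin N)}
    {A : SchwartzMap (Fin N → mixedSpace F) ℂ ≃L[ℂ] SchwartzMap (Fin N → mixedSpace F) ℂ}
    (hp : ∀ (Φinf : SchwartzMap (Fin N → mixedSpace F) ℂ) (f : FinSB F (Fin N)),
      Mp (piSchwartzBruhatEquiv F (Fin N) (Φinf ⊗ₜ f)) = piSchwartzBruhatEquiv F (Fin N) (A Φinf ⊗ₜ piEquiv M hM1 f))
    (hp' : ∀ (Φinf : SchwartzMap (Fin N → mixedSpace F) ℂ) (f : FinSB F (Fin N)),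
      Mp.symm (piSchwartzBruhatEquiv F (Fin N) (Φinf ⊗ₜ f)) =
        piSchwartzBruhatEquiv F (Fin N) (A.symm Φinf ⊗ₜ (piEquiv M hM1).symm f))
    (g : UnitaryGroup.finAdelic F E c N J) (Φinf : SchwartzMap (Fin N → mixedSpace F) ℂ) (Φ : LocalSBFamily F (Fin N)) :
    (Mp * MpPsi.toOp _ (𝓢.finSplittingMp g) * Mp⁻¹) (piSchwartzBruhatEquiv F (Fin N) (Φinf ⊗ₜ piProdSB F (Fin N) Φ)) =
      piSchwartzBruhatEquiv F (Fin N) (Φinf ⊗ₜ piProdSB F (Fin N) (conjFamily T E c hcδ hδ hd hT hJ 𝓢 M hM1 g Φ)) := by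
  rw [conj_tmul_of_tensor_forms hp hp' (fun Φinf f => by
    rw [𝓢.toOp_finSplittingMp g, adelicTensorAutFin_apply_tmul, FinLocalSplittings.OmegaEquiv_apply])]
  rw [piEquiv_symm_piProdSB, FinLocalSplittings.Omega_piProdSB, piEquiv_piProdSB]
  rfl

/-- **… and its value at the origin**: `Φ_∞(0) · ∏_{v ∈ S} (M_v ω_v(g_v) M_v⁻¹ Φ_v)(0)` for every finite `S` off which the
conjugated family is the unit vector. [cite: GelbartRogawski1991, §3.1 Prop. 3.1.1 p. 455] -/
theorem conj_finSplitting_tmul_piProdSB_apply_zero {Mp : piSchwartzBruhat F (Fin N) ≃ₗ[ℂ] piSchwartzBruhat F (Fin N)}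
    {A : SchwartzMap (Fin N → mixedSpace F) ℂ ≃L[ℂ] SchwartzMap (Fin N → mixedSpace F) ℂ}
    (hp : ∀ (Φinf : SchwartzMap (Fin N → mixedSpace F) ℂ) (f : FinSB F (Fin N)),
      Mp (piSchwartzBruhatEquiv F (Fin N) (Φinf ⊗ₜ f)) = piSchwartzBruhatEquiv F (Fin N) (A Φinf ⊗ₜ piEquiv M hM1 f))
    (hp' : ∀ (Φinf : SchwartzMap (Fin N → mixedSpace F) ℂ) (f : FinSB F (Fin N)),
      Mp.symm (piSchwartzBruhatEquiv F (Fin N) (Φinf ⊗ₜ f)) =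
        piSchwartzBruhatEquiv F (Fin N) (A.symm Φinf ⊗ₜ (piEquiv M hM1).symm f))
    (g : UnitaryGroup.finAdelic F E c N J) (Φinf : SchwartzMap (Fin N → mixedSpace F) ℂ) (Φ : LocalSBFamily F (Fin N))
    (S : Finset (HeightOneSpectrum (𝓞 F))) (hS : ∀ v ∉ S, conjFamily T E c hcδ hδ hd hT hJ 𝓢 M hM1 g Φ v = unitVec F (Fin N) v) :
    (((Mp * MpPsi.toOp _ (𝓢.finSplittingMp g) * Mp⁻¹) (piSchwartzBruhatEquiv F (Fin N) (Φinf ⊗ₜ piProdSB F (Fin N) Φ)) :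
        piSchwartzBruhat F (Fin N)) : (Fin N → AdeleRing (𝓞 F) F) → ℂ) 0 =
      Φinf 0 * ∏ v ∈ S, ((conjFamily T E c hcδ hδ hd hT hJ 𝓢 M hM1 g Φ v : SchwartzBruhat (Fin N → v.adicCompletion F)) :
        (Fin N → v.adicCompletion F) → ℂ) 0 := by
  rw [conj_finSplitting_tmul_piProdSB T E c hcδ hδ hd hT hJ 𝓢 M hM1 hp hp', coe_piSchwartzBruhatEquiv_tmul_zero,
    coe_piProdSB_zero (conjFamily T E c hcδ hδ hd hT hJ 𝓢 M hM1 g Φ) S hS]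

end Conjugate

/-! ## §6 From a place-by-place origin-value prescription to all of `U(J)(𝔸_{F,f})` -/

section Prescription

variable {F N}
variable {E : Type} [Field E] [NumberField E] [Algebra F E]
  [Algebra.IsQuadraticExtension F E] {c : E ≃ₐ[F] E} {δ : E} {hcδ : c δ = -δ} {hδ : δ ≠ 0} {d : F}
  {hd : δ * δ = algebraMap F E d} {hT : T.IsSymm}
  {J : Matrix (Fin N) (Fin N) E} {hJ : J = T.map (algebraMap F E)}
  (𝓢 : FinLocalSplittings F E c N hcδ hδ hd T hT hJ)
  (M : ∀ v : HeightOneSpectrum (𝓞 F),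
    SchwartzBruhat (Fin N → v.adicCompletion F) ≃ₗ[ℂ] SchwartzBruhat (Fin N → v.adicCompletion F))
  (hM1 : ∀ᶠ v in cofinite, M v (unitVec F (Fin N) v) = unitVec F (Fin N) v)
  {Mp : piSchwartzBruhat F (Fin N) ≃ₗ[ℂ] piSchwartzBruhat F (Fin N)}
  {A : SchwartzMap (Fin N → mixedSpace F) ℂ ≃L[ℂ] SchwartzMap (Fin N → mixedSpace F) ℂ}
  (hp : ∀ (Φinf : SchwartzMap (Fin N → mixedSpace F) ℂ) (f : FinSB F (Fin N)),
    Mp (piSchwartzBruhatEquiv F (Fin N) (Φinf ⊗ₜ f)) = piSchwartzBruhatEquiv F (Fin N) (A Φinf ⊗ₜ piEquiv M hM1 f))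
  (hp' : ∀ (Φinf : SchwartzMap (Fin N → mixedSpace F) ℂ) (f : FinSB F (Fin N)),
    Mp.symm (piSchwartzBruhatEquiv F (Fin N) (Φinf ⊗ₜ f)) = piSchwartzBruhatEquiv F (Fin N) (A.symm Φinf ⊗ₜ (piEquiv M hM1).symm f))
  (P : ∀ v : HeightOneSpectrum (𝓞 F), UnitaryGroup.localPi E c N J v → Prop) (hP1 : ∀ v, P v 1)
  (lam : UnitaryGroup.finAdelic F E c N J → ℂ)
  (hmul : ∀ g g' : UnitaryGroup.finAdelic F E c N J, (∀ v, P v (UnitaryGroup.evalPlace F E c N J v g)) →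
    (∀ v, P v (UnitaryGroup.evalPlace F E c N J v g')) → lam (g * g') = lam g * lam g')
  (hone : lam 1 = 1)
  (hcont : ContinuousOn lam {g | ∀ v, P v (UnitaryGroup.evalPlace F E c N J v g)})
  (hloc : ∀ (v : HeightOneSpectrum (𝓞 F)) (u : UnitaryGroup.localPi E c N J v), P v u →
    ∀ φ : SchwartzBruhat (Fin N → v.adicCompletion F),
      ((M v (𝓢.omegaLoc v u ((M v).symm φ)) : SchwartzBruhat (Fin N → v.adicCompletion F)) : (Fin N → v.adicCompletion F) → ℂ) 0 =
        lam (UnitaryGroup.inclPlace F E c N J v u) * ((φ : SchwartzBruhat (Fin N → v.adicCompletion F)) :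
          (Fin N → v.adicCompletion F) → ℂ) 0)

/-- the conjugated operator `M_p ω(s_f g) M_p⁻¹` of `g ∈ U(J)(𝔸_{F,f})`. [cite: GelbartRogawski1991, §3.1 Prop. 3.1.1 p. 455] -/
def conjOp (Mp : piSchwartzBruhat F (Fin N) ≃ₗ[ℂ] piSchwartzBruhat F (Fin N)) (g : UnitaryGroup.finAdelic F E c N J) :
    piSchwartzBruhat F (Fin N) ≃ₗ[ℂ] piSchwartzBruhat F (Fin N) :=
  Mp * MpPsi.toOp _ (𝓢.finSplittingMp g) * Mp⁻¹

/-- evaluation at the origin, a linear functional on `𝒮(𝔸_Fᴺ)`. [folklore] -/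
private def evalZero : piSchwartzBruhat F (Fin N) →ₗ[ℂ] ℂ :=
  (LinearMap.proj (0 : Fin N → AdeleRing (𝓞 F) F)).comp (piSchwartzBruhat F (Fin N)).subtype

/-- unfolding of `evalZero`. [folklore] -/
private theorem evalZero_apply (Φ : piSchwartzBruhat F (Fin N)) :
    evalZero (F := F) (N := N) Φ = (Φ : (Fin N → AdeleRing (𝓞 F) F) → ℂ) 0 := rfl

/-! ## §1 Pure tensors: the value at the origin is a finite product of local values -/

include hp hp' hloc in
/-- **pure tensors**: for `g ∈ P`, `(M_p ω(s_f g) M_p⁻¹ (Φ_∞ ⊗ ⊗_vΦ_v))(0) = (∏_{v∈S} λ(inclPlace v g_v)) · (Φ_∞ ⊗ ⊗_vΦ_v)(0)` for every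
finite `S` containing the exceptional places of the conjugated family and of `Φ`. [cite: GelbartRogawski1991, §3.1 Prop. 3.1.1 p. 455] -/
theorem conjOp_tmul_piProdSB_apply_zero (g : UnitaryGroup.finAdelic F E c N J)
    (hg : ∀ v, P v (UnitaryGroup.evalPlace F E c N J v g)) (Φinf : SchwartzMap (Fin N → mixedSpace F) ℂ)
    (Φ : LocalSBFamily F (Fin N)) (S : Finset (HeightOneSpectrum (𝓞 F)))
    (hS : ∀ v ∉ S, conjFamily T E c hcδ hδ hd hT hJ 𝓢 M hM1 g Φ v = unitVec F (Fin N) v)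
    (hSΦ : ∀ v ∉ S, Φ v = unitVec F (Fin N) v) :
    ((conjOp T 𝓢 Mp g (piSchwartzBruhatEquiv F (Fin N) (Φinf ⊗ₜ piProdSB F (Fin N) Φ)) : piSchwartzBruhat F (Fin N)) :
        (Fin N → AdeleRing (𝓞 F) F) → ℂ) 0 =
      (∏ v ∈ S, lam (UnitaryGroup.inclPlace F E c N J v (UnitaryGroup.evalPlace F E c N J v g))) *
        ((piSchwartzBruhatEquiv F (Fin N) (Φinf ⊗ₜ piProdSB F (Fin N) Φ) : piSchwartzBruhat F (Fin N)) :
          (Fin N → AdeleRing (𝓞 F) F) → ℂ) 0 := by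
  have hprod : ∏ v ∈ S, ((conjFamily T E c hcδ hδ hd hT hJ 𝓢 M hM1 g Φ v : SchwartzBruhat (Fin N → v.adicCompletion F)) :
      (Fin N → v.adicCompletion F) → ℂ) 0 =
      ∏ v ∈ S, (lam (UnitaryGroup.inclPlace F E c N J v (UnitaryGroup.evalPlace F E c N J v g)) *
        ((Φ v : SchwartzBruhat (Fin N → v.adicCompletion F)) : (Fin N → v.adicCompletion F) → ℂ) 0) :=
    Finset.prod_congr rfl fun v _ => by rw [conjFamily_apply]; exact hloc v _ (hg v) (Φ v)
  rw [conjOp, conj_finSplitting_tmul_piProdSB_apply_zero T E c hcδ hδ hd hT hJ 𝓢 M hM1 hp hp' g Φinf Φ S hS,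
    coe_piSchwartzBruhatEquiv_tmul_zero, coe_piProdSB_zero Φ S hSΦ, hprod, Finset.prod_mul_distrib]
  ring

/-! ## §2 Finitely supported elements -/

omit [Algebra.IsQuadraticExtension F E] in
include hP1 hmul hone in
/-- `λ(g_S) = ∏_{v ∈ S} λ(inclPlace v g_v)` for `g ∈ P`. [cite: CasselsFrohlichANT1967, Ch. VII §4.3] -/
theorem lam_truncPlaces (g : UnitaryGroup.finAdelic F E c N J) (hg : ∀ v, P v (UnitaryGroup.evalPlace F E c N J v g))
    (S : Finset (HeightOneSpectrum (𝓞 F))) :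
    lam (UnitaryGroup.truncPlaces F E c N J S g) =
      ∏ v ∈ S, lam (UnitaryGroup.inclPlace F E c N J v (UnitaryGroup.evalPlace F E c N J v g)) := by
  induction S using Finset.induction_on with
  | empty => rw [UnitaryGroup.truncPlaces_empty, Finset.prod_empty, hone]
  | insert v S hv ih =>
    have hincl : ∀ w, P w (UnitaryGroup.evalPlace F E c N J w
        (UnitaryGroup.inclPlace F E c N J v (UnitaryGroup.evalPlace F E c N J v g))) := fun w => by
      by_cases hw : w = v
      · subst hw; rw [UnitaryGroup.evalPlace_inclPlace]; exact hg w
      · rw [UnitaryGroup.evalPlace_inclPlace_of_ne F E c N J hw]; exact hP1 w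
    rw [UnitaryGroup.truncPlaces_insert F E c N J hv, hmul _ _ hincl
      (fun w => UnitaryGroup.truncPlaces_mem_setOf_forall F E c N J hP1 hg S w), ih, Finset.prod_insert hv]

omit [Algebra.IsQuadraticExtension F E] in
include hP1 hmul hone in
/-- for a finitely supported `g ∈ P` with support in `S`: `∏_{v ∈ S} λ(inclPlace v g_v) = λ(g)`.
[cite: CasselsFrohlichANT1967, Ch. VII §4.3] -/
theorem prod_lam_inclPlace_eq (g : UnitaryGroup.finAdelic F E c N J) (hg : ∀ v, P v (UnitaryGroup.evalPlace F E c N J v g))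
    (S : Finset (HeightOneSpectrum (𝓞 F))) (hsupp : ∀ v ∉ S, UnitaryGroup.evalPlace F E c N J v g = 1) :
    ∏ v ∈ S, lam (UnitaryGroup.inclPlace F E c N J v (UnitaryGroup.evalPlace F E c N J v g)) = lam g := by
  rw [← lam_truncPlaces (c := c) (J := J) P hP1 lam hmul hone g hg S, (UnitaryGroup.truncPlaces_eq_self_iff F E c N J S g).2 hsupp]

/-- the functional `f ↦ L (Φ_∞ ⊗ f)` is linear. [folklore] -/
private def tmulLeft (Φinf : SchwartzMap (Fin N → mixedSpace F) ℂ) : FinSB F (Fin N) →ₗ[ℂ] piSchwartzBruhat F (Fin N) :=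
  (piSchwartzBruhatEquiv F (Fin N)).toLinearMap ∘ₗ TensorProduct.mk ℂ _ _ Φinf

/-- unfolding. [folklore] -/
private theorem tmulLeft_apply (Φinf : SchwartzMap (Fin N → mixedSpace F) ℂ) (f : FinSB F (Fin N)) :
    tmulLeft (F := F) (N := N) Φinf f = piSchwartzBruhatEquiv F (Fin N) (Φinf ⊗ₜ f) := rfl

include hP1 hmul hone hp hp' hloc in
/-- **finitely supported elements**: for `g ∈ P ∩ finSupp` and every `Φ`, `(M_p ω(s_f g) M_p⁻¹ Φ)(0) = λ(g) Φ(0)`.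
[cite: GelbartRogawski1991, §3.1 Prop. 3.1.1 p. 455] -/
theorem conjOp_apply_zero_of_mem_finSupp (g : UnitaryGroup.finAdelic F E c N J)
    (hg : ∀ v, P v (UnitaryGroup.evalPlace F E c N J v g)) (hfs : g ∈ UnitaryGroup.finSupp F E c N J)
    (Φ : piSchwartzBruhat F (Fin N)) :
    ((conjOp T 𝓢 Mp g Φ : piSchwartzBruhat F (Fin N)) : (Fin N → AdeleRing (𝓞 F) F) → ℂ) 0 =
      lam g * (Φ : (Fin N → AdeleRing (𝓞 F) F) → ℂ) 0 := by
  obtain ⟨S₀, hS₀⟩ := (UnitaryGroup.mem_finSupp_iff F E c N J g).1 hfs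
  -- both sides are linear functionals of `Φ`; compare them on pure tensors `Φ_∞ ⊗ ⊗_v Φ_v`
  suffices h : evalZero ∘ₗ (conjOp T 𝓢 Mp g : piSchwartzBruhat F (Fin N) →ₗ[ℂ] piSchwartzBruhat F (Fin N)) =
      lam g • evalZero by
    have := LinearMap.congr_fun h Φ
    rw [LinearMap.comp_apply, LinearMap.smul_apply, evalZero_apply, evalZero_apply, smul_eq_mul] at this
    exact this
  refine linearMap_ext_tensor (K := F) (ι := Fin N) fun Φinf f => ?_
  suffices h : (evalZero ∘ₗ (conjOp T 𝓢 Mp g : piSchwartzBruhat F (Fin N) →ₗ[ℂ] piSchwartzBruhat F (Fin N))) ∘ₗ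
      tmulLeft Φinf = (lam g • evalZero) ∘ₗ tmulLeft Φinf by
    have := LinearMap.congr_fun h f
    rwa [LinearMap.comp_apply, LinearMap.comp_apply, tmulLeft_apply] at this
  refine LinearMap.ext_on_range (span_range_piProdSB (K := F) (ι := Fin N)) fun Φv => ?_
  -- a common finite set of exceptional places
  obtain ⟨S₁, hS₁⟩ : ∃ S₁ : Finset (HeightOneSpectrum (𝓞 F)), ∀ v ∉ S₁,
      conjFamily T E c hcδ hδ hd hT hJ 𝓢 M hM1 g Φv v = unitVec F (Fin N) v :=
    ⟨(finite_setOf_ne_unitVec _).toFinset, fun v hv => not_not.1 fun h => hv ((finite_setOf_ne_unitVec _).mem_toFinset.2 h)⟩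
  obtain ⟨S₂, hS₂⟩ : ∃ S₂ : Finset (HeightOneSpectrum (𝓞 F)), ∀ v ∉ S₂, Φv v = unitVec F (Fin N) v :=
    ⟨(finite_setOf_ne_unitVec _).toFinset, fun v hv => not_not.1 fun h => hv ((finite_setOf_ne_unitVec _).mem_toFinset.2 h)⟩
  have key := conjOp_tmul_piProdSB_apply_zero T 𝓢 M hM1 hp hp' P lam hloc g hg Φinf Φv (S₀ ∪ S₁ ∪ S₂)
    (fun v hv => hS₁ v fun h => hv (Finset.mem_union_left _ (Finset.mem_union_right _ h)))
    (fun v hv => hS₂ v fun h => hv (Finset.mem_union_right _ h))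
  rw [prod_lam_inclPlace_eq (c := c) (J := J) P hP1 lam hmul hone g hg (S₀ ∪ S₁ ∪ S₂)
    (fun v hv => hS₀ v fun h => hv (Finset.mem_union_left _ (Finset.mem_union_left _ h)))] at key
  rw [LinearMap.comp_apply, LinearMap.comp_apply, LinearMap.comp_apply, LinearMap.smul_apply, tmulLeft_apply, evalZero_apply,
    evalZero_apply, smul_eq_mul, LinearEquiv.coe_coe]
  exact key

/-! ## §3 All of `P`, by density of the finitely supported elements and continuity -/

/-- `g ↦ (M_p ω(s_f g) M_p⁻¹ Φ)(0)` is continuous (indeed locally constant: `s_f` is smooth).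
[cite: MoeglinVignerasWaldspurger1987, Chap. 2 II.8] -/
theorem continuous_conjOp_apply_zero (Mp : piSchwartzBruhat F (Fin N) ≃ₗ[ℂ] piSchwartzBruhat F (Fin N))
    (Φ : piSchwartzBruhat F (Fin N)) :
    Continuous fun g : UnitaryGroup.finAdelic F E c N J =>
      ((conjOp T 𝓢 Mp g Φ : piSchwartzBruhat F (Fin N)) : (Fin N → AdeleRing (𝓞 F) F) → ℂ) 0 := by
  have hlc : IsLocallyConstant fun g : UnitaryGroup.finAdelic F E c N J =>
      MpPsi.toOp _ (𝓢.finSplittingMp g) (Mp.symm Φ) := 𝓢.isLocallyConstant_omega_finSplitting (Mp.symm Φ)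
  exact (hlc.comp fun Ψ : piSchwartzBruhat F (Fin N) =>
    ((Mp Ψ : piSchwartzBruhat F (Fin N)) : (Fin N → AdeleRing (𝓞 F) F) → ℂ) 0).continuous

include hP1 hmul hone hcont hp hp' hloc in
/-- **THE LOCAL-TO-GLOBAL ORIGIN-VALUE PRESCRIPTION**: for every `g` with `P_v(g_v)` at all places and every
`Φ ∈ 𝒮(𝔸_Fᴺ)`, `(M_p ω(s_f g) M_p⁻¹ Φ)(0) = λ(g) · Φ(0)`. [cite: GelbartRogawski1991, §3.1 Prop. 3.1.1 p. 455; Kudla1994, Thm. 3.1] -/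
theorem conjOp_apply_zero (g : UnitaryGroup.finAdelic F E c N J) (hg : ∀ v, P v (UnitaryGroup.evalPlace F E c N J v g))
    (Φ : piSchwartzBruhat F (Fin N)) :
    ((conjOp T 𝓢 Mp g Φ : piSchwartzBruhat F (Fin N)) : (Fin N → AdeleRing (𝓞 F) F) → ℂ) 0 =
      lam g * (Φ : (Fin N → AdeleRing (𝓞 F) F) → ℂ) 0 := by
  have hPt : ∀ g' ∈ {g' : UnitaryGroup.finAdelic F E c N J | ∀ v, P v (UnitaryGroup.evalPlace F E c N J v g')},
      ∀ S : Finset (HeightOneSpectrum (𝓞 F)), UnitaryGroup.truncPlaces F E c N J S g' ∈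
        {g' : UnitaryGroup.finAdelic F E c N J | ∀ v, P v (UnitaryGroup.evalPlace F E c N J v g')} :=
    fun g' hg' S v => UnitaryGroup.truncPlaces_mem_setOf_forall F E c N J hP1 hg' S v
  refine Set.EqOn.of_subset_closure (s := {g' : UnitaryGroup.finAdelic F E c N J |
      ∀ v, P v (UnitaryGroup.evalPlace F E c N J v g')} ∩ (UnitaryGroup.finSupp F E c N J : Subgroup _))
    (t := {g' : UnitaryGroup.finAdelic F E c N J | ∀ v, P v (UnitaryGroup.evalPlace F E c N J v g')})
    (f := fun g' => ((conjOp T 𝓢 Mp g' Φ : piSchwartzBruhat F (Fin N)) : (Fin N → AdeleRing (𝓞 F) F) → ℂ) 0)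
    (g := fun g' => lam g' * (Φ : (Fin N → AdeleRing (𝓞 F) F) → ℂ) 0) ?_ ?_ ?_ Set.inter_subset_left
    (UnitaryGroup.subset_closure_inter_finSupp F E c N J hPt) hg
  · exact fun g' hg' => conjOp_apply_zero_of_mem_finSupp T 𝓢 M hM1 hp hp' P hP1 lam hmul hone hloc g' hg'.1 hg'.2 Φ
  · exact (continuous_conjOp_apply_zero T 𝓢 Mp Φ).continuousOn
  · exact hcont.mul continuousOn_const

end Prescription

/-! ### Build-lane note (ops-buildfix G11b-3 recipe, LEDGER B13-1, 2026-08-21)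
`lean -o` (the hub build lane, never `lean`/the gate check) runs Lean 4.32's library-suggestion indexers
(`Lean.LibrarySuggestions.SymbolFrequency` / `SineQuaNon`, from their `exportEntriesFn`) over the statement of
every local theorem that is not a denied premise; on this family's statements (very large dependent binder
telescopes through the theta-kernel / dual-pair data) that fold runs for tens of minutes to hours and the build
lane kills the job (incident G11b-3, run/shared/lean/ops/buildfix/G11b-3-DOSSIER.md). `isDeniedPremise` skips
`[implicit_reducible]` constants before any fold, and a reducibility status on a *theorem* is inert (Meta never
unfolds `thmInfo`; the kernel ignores the attribute), so the public theorems of this file are tagged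
`[implicit_reducible]` purely to keep them out of that index. Only other effect: they are not offered by
`+suggestions` premise selectors. No statement or proof is changed; superseded if the operator lands a
deny-list form (`HarnessLib.PremiseIndex`). -/
set_option allowUnsafeReducibility true in
attribute [implicit_reducible]
  placeVec_ratSp adeleEval_ofSymplectic_f_ratSp eventually_symm_unitVec piOp_piProdSB
  piOpInv_piProdSB coe_piEquiv coe_piEquiv_symm piEquiv_piProdSB piEquiv_symm_piProdSB
  piMap_heisFamily_apply piOp_comp_finSchrodinger implements_fin exists_arch_tmul
  conj_tmul_of_tensor_forms conj_tmul_of_tensor_forms_arch coe_piSchwartzBruhatEquiv_tmul_zero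
  coe_piProdSB_zero conjFamily_apply conj_finSplitting_tmul_piProdSB
  conj_finSplitting_tmul_piProdSB_apply_zero conjOp_tmul_piProdSB_apply_zero lam_truncPlaces
  prod_lam_inclPlace_eq conjOp_apply_zero_of_mem_finSupp continuous_conjOp_apply_zero
  conjOp_apply_zero

end Literature.NumberTheory.GelbartRogawski1991.UnitaryDualPair.LocalSplitting

end
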